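/-
Copyright: the b2b-balaban T⁴-continuum CRUX team, row NE7b OWNER lineage `t4-ne7b-p1` (gen 144). Project licence.
-/
import Summits.QuantumFields.BalabanUV.T4Continuum.Spine.NE7b.SupFifthKernelEntryLetterSlotThreeA
import Summits.QuantumFields.BalabanUV.T4Continuum.Spine.NE7b.SupFifthKernelEntryLetterSlotThreeB
import Summits.QuantumFields.BalabanUV.T4Continuum.Spine.NE7b.SupFifthKernelEntryLetterSlotThreeC
import Summits.QuantumFields.BalabanUV.T4Continuum.Spine.NE7b.SupFifthKernelEntryLetterSlotThreeD

/-!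
# THE SLOT LETTER `k5s2⁺` OF THE ORDER-FIVE ENTRY MAJORANT — THE END (display index `z` fixed, row index summed; the order-5 block of
# the kernel-letter CLASS MAP; finite sums).  The six block sums of (620)–(623) added: `Σ M ≤` the written-out letter below, in the
# input's letters (incl. the NEW `k5s2, k5s3, k5s4, k3m` and the support counts in all roles) (row NE7b, node U5c; (620)–(623), (611)
# BY NAME; [folklore] finite sums)

Cell `pub-balaban`, sub-cell `t4`, spine estimate NE7b (`T4WeightBudget.RelWeightBound`; the cell's OWN estimate — NOT PRINTED in
[Bałaban 1983–89], NOT PROVED).  Crux-route work under `Spine/NE7b/` by the row OWNER (`t4-ne7b-p1` gen 144, file (624)) under FREEZE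
(0)'s crux-prover clause; NOTHING of Bałaban's is named as a Lean object, valued or asserted; no `T4Continuum/Support` leaf typed; no
`def`, no notation (the majorant blocks WRITTEN OUT as in (610)); zero `sorry`.  Imports (BY NAME): the OWNER's (620)–(623).

WHAT IS PROVED ([folklore]): THE END **`entry_majorant5_slot_z`**; toy.

HONEST (what this is NOT).  Finite sums; the Schur operator letter and the packaging are the next files.  Scalar skeleton ((A3), NC-NE7b-α
UNRULED); nothing of Bałaban's asserted.
BY-NAME EFFECT ON THE WALL: NONE.  NE7b NOT PRINTED ∕ NOT PROVED; spine PROVED 0∕9; rung (B)+1 — the programme's measures remain FINITE-torus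
statements; NOT the mass gap, NOT Clay.  HONEST DEPENDENCY: continuum YM on T⁴ ⇐ BetaPertH ∧ nine spine estimates (0∕9 proved); BetaPertH ⇐
(D1) ∧ (D4) ∧ CAP+tail; G-an2-4 gates asym, D1 and NE2∕3∕4.
-/

set_option autoImplicit false

noncomputable section

namespace Summit.QuantumFields.BalabanUV.T4Continuum.NE7b.SupFifthKernelEntryLetterSlotThree

open Finset Real Matrix
open scoped BigOperators
open SupFifthKernelSlotTools (sum4_add)
open SupFifthKernelEntryLetterSlotThreeA (slot_z_mean slot_z_covCA slot_z_covBB)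
open SupFifthKernelEntryLetterSlotThreeB (slot_z_kappa3B)
open SupFifthKernelEntryLetterSlotThreeC (slot_z_kappa3A)
open SupFifthKernelEntryLetterSlotThreeD (slot_z_u4)

variable {ι κ : Type} [Fintype ι] [DecidableEq ι] [Fintype κ] [DecidableEq κ]

variable {Hk : ι → ι → ℝ} {K3 : ι → ι → ι → ℝ} {K4 : ι → ι → ι → ι → ℝ} {K5 : ι → ι → ι → ι → ι → ℝ} {A : Matrix ι κ ℝ} {D : κ → κ → ℝ}
  {lamA αr αc hr hc k3r k3m k3c k4r k4s2 k4s3 k4c k5r k5s2 k5s3 k5s4 k5c dr dc S S' S₁ n₃ C3k C3h C4 C5 : ℝ} {ρ r : ι → ι → ℝ} {n : ℕ}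

omit [DecidableEq ι] [DecidableEq κ] in
set_option maxHeartbeats 6000000 in
set_option maxRecDepth 4096 in
/-- **THE SLOT LETTER `k5s2⁺`**: `Σ M` over the other three display indices and the row index, `z` fixed. [folklore] -/
theorem entry_majorant5_slot_z [Nonempty κ]
    (hK50 : ∀ x y z t u, 0 ≤ K5 x y z t u) (hK40 : ∀ x y z u, 0 ≤ K4 x y z u) (hK30 : ∀ x y u, 0 ≤ K3 x y u) (hHk0 : ∀ v u, 0 ≤ Hk v u)
    (hhr : ∀ v, ∑ u, Hk v u ≤ hr) (hhc : ∀ u, ∑ v, Hk v u ≤ hc) (hk3r : ∀ x, ∑ y, ∑ u, K3 x y u ≤ k3r) (hk3m : ∀ y, ∑ x, ∑ u, K3 x y u ≤ k3m)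
    (hk3c : ∀ u, ∑ y, ∑ z, K3 y z u ≤ k3c) (hk4r : ∀ x, ∑ y, ∑ z, ∑ u, K4 x y z u ≤ k4r) (hk4s2 : ∀ y, ∑ x, ∑ t, ∑ u, K4 x y t u ≤ k4s2)
    (hk4s3 : ∀ z, ∑ x, ∑ y, ∑ u, K4 x y z u ≤ k4s3) (hk4c : ∀ u, ∑ y, ∑ z, ∑ t, K4 y z t u ≤ k4c)
    (hk5s2 : ∀ y, ∑ x, ∑ z, ∑ t, ∑ u, K5 x y z t u ≤ k5s2) (hk5s3 : ∀ z, ∑ x, ∑ y, ∑ t, ∑ u, K5 x y z t u ≤ k5s3)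
    (hk5c : ∀ u, ∑ y, ∑ z, ∑ t, ∑ s, K5 y z t s u ≤ k5c) (hαr : ∀ u, ∑ w, |A u w| ≤ αr) (hαc : ∀ w, ∑ u, |A u w| ≤ αc) (hlamA1 : lamA < 1)
    (hD : ∀ x y, 0 ≤ D x y) (hDr : ∀ z, ∑ w, D z w ≤ dr) (hDc : ∀ w, ∑ z, D z w ≤ dc) (hρ1 : ∀ x y, 1 ≤ ρ x y) (hρsymm : ∀ x y, ρ x y = ρ y x)
    (hS : ∀ u, ∑ v, 1 / ρ u v ≤ S) (hr1 : ∀ x y, 1 ≤ r x y) (hrs : ∀ u v, r u v = r v u) (hSr : ∀ u, ∑ v, (r u v ^ 2)⁻¹ ≤ S')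
    (hSc : ∀ v, ∑ u, (r u v ^ 2)⁻¹ ≤ S') (hS1 : ∀ u, ∑ v, (r u v)⁻¹ ≤ S₁) (hn : ∀ y : ι, (Finset.univ.filter (fun z => Hk z y ≠ 0)).card ≤ n)
    (hn' : ∀ z : ι, (Finset.univ.filter (fun y => Hk z y ≠ 0)).card ≤ n)
    (hn3 : ∀ y : ι, ∑ z, ((Finset.univ.filter (fun t => K3 z t y ≠ 0)).card : ℝ) ≤ n₃)
    (hn3f : ∀ a : ι, ∑ b, ((Finset.univ.filter (fun c => K3 a b c ≠ 0)).card : ℝ) ≤ n₃)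
    (hn3m : ∀ b : ι, ∑ a, ((Finset.univ.filter (fun c => K3 a b c ≠ 0)).card : ℝ) ≤ n₃) (hC3k0 : 0 ≤ C3k) (hC3h0 : 0 ≤ C3h) (hC40 : 0 ≤ C4)
    (hC50 : 0 ≤ C5) (z : ι) :
    ∑ y, ∑ t, ∑ s, ∑ x, (((K5 y z t s x : ℝ) + (∑ w, (∑ z', D z' w * ∑ u, |A u z'| * Hk x u) * (∑ z', D z' w * ∑ u, |A u z'| * K5 y z t s u) / (1 -
        lamA) : ℝ)) +
        ((∑ w, (∑ z', D z' w * ∑ u, |A u z'| * K5 x y t s u) * (∑ z', D z' w * ∑ u, |A u z'| * Hk z u) / (1 - lamA) : ℝ) + (∑ w, (∑ z', D z' w * ∑ u,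
            |A u z'| * K3 x z u) * (∑ z', D z' w * ∑ u, |A u z'| * K4 y t s u) / (1 - lamA) : ℝ) + (if K3 t s y = 0 then 0 else C3k / (ρ x y * ρ x z)
            : ℝ) + (∑ w, (∑ z', D z' w * ∑ u, |A u z'| * K5 x y z s u) * (∑ z', D z' w * ∑ u, |A u z'| * Hk t u) / (1 - lamA) : ℝ) + (∑ w, (∑ z', D
            z' w * ∑ u, |A u z'| * K3 x t u) * (∑ z', D z' w * ∑ u, |A u z'| * K4 y z s u) / (1 - lamA) : ℝ) + (if K3 z s y = 0 then 0 else C3k / (ρ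
            x y * ρ x t) : ℝ) + (∑ w, (∑ z', D z' w * ∑ u, |A u z'| * K5 x y z t u) * (∑ z', D z' w * ∑ u, |A u z'| * Hk s u) / (1 - lamA) : ℝ) + (∑
            w, (∑ z', D z' w * ∑ u, |A u z'| * K3 x s u) * (∑ z', D z' w * ∑ u, |A u z'| * K4 y z t u) / (1 - lamA) : ℝ) + (if K3 z t y = 0 then 0
            else C3k / (ρ x y * ρ x s) : ℝ) + (∑ w, (∑ z', D z' w * ∑ u, |A u z'| * K3 x y u) * (∑ z', D z' w * ∑ u, |A u z'| * K4 z t s u) / (1 -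
            lamA) : ℝ) + (∑ w, (∑ z', D z' w * ∑ u, |A u z'| * K5 x z t s u) * (∑ z', D z' w * ∑ u, |A u z'| * Hk y u) / (1 - lamA) : ℝ) + (if K3 t s
            z = 0 then 0 else C3k / (ρ x z * ρ x y) : ℝ)) +
        ((∑ w, (∑ z', D z' w * ∑ u, |A u z'| * K4 x y z u) * (∑ z', D z' w * ∑ u, |A u z'| * K3 t s u) / (1 - lamA) : ℝ) + (∑ w, (∑ z', D z' w * ∑ u,
            |A u z'| * K4 x t s u) * (∑ z', D z' w * ∑ u, |A u z'| * K3 y z u) / (1 - lamA) : ℝ) + (if Hk z y = 0 then 0 else if Hk s t = 0 then 0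
            else C3h / (ρ x y * ρ x t) : ℝ) + (∑ w, (∑ z', D z' w * ∑ u, |A u z'| * K4 x y t u) * (∑ z', D z' w * ∑ u, |A u z'| * K3 z s u) / (1 -
            lamA) : ℝ) + (∑ w, (∑ z', D z' w * ∑ u, |A u z'| * K4 x z s u) * (∑ z', D z' w * ∑ u, |A u z'| * K3 y t u) / (1 - lamA) : ℝ) + (if Hk t y
            = 0 then 0 else if Hk s z = 0 then 0 else C3h / (ρ x y * ρ x z) : ℝ) + (∑ w, (∑ z', D z' w * ∑ u, |A u z'| * K4 x y s u) * (∑ z', D z' w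
            * ∑ u, |A u z'| * K3 z t u) / (1 - lamA) : ℝ) + (∑ w, (∑ z', D z' w * ∑ u, |A u z'| * K4 x z t u) * (∑ z', D z' w * ∑ u, |A u z'| * K3 y
            s u) / (1 - lamA) : ℝ) + (if Hk s y = 0 then 0 else if Hk t z = 0 then 0 else C3h / (ρ x y * ρ x z) : ℝ)) +
        ((if K3 y z x = 0 then 0 else C3k / (ρ x t * ρ x s) : ℝ) + (if Hk t x = 0 then 0 else if Hk z y = 0 then 0 else C3h / (ρ x y * ρ x s) : ℝ) +
            (if Hk s x = 0 then 0 else if Hk z y = 0 then 0 else C3h / (ρ x y * ρ x t) : ℝ) + (if Hk z y = 0 then 0 else C4 * (((r x y ^ 2)⁻¹ * (r x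
            t ^ 2)⁻¹ * (r x s ^ 2)⁻¹ + (r x y ^ 2)⁻¹ * (r y t ^ 2)⁻¹ * (r y s ^ 2)⁻¹ + (r x t ^ 2)⁻¹ * (r y t ^ 2)⁻¹ * (r t s ^ 2)⁻¹ + (r x s ^ 2)⁻¹
            * (r y s ^ 2)⁻¹ * (r t s ^ 2)⁻¹ + (r x y ^ 2)⁻¹ * (r y t ^ 2)⁻¹ * (r t s ^ 2)⁻¹ + (r x y ^ 2)⁻¹ * (r y s ^ 2)⁻¹ * (r t s ^ 2)⁻¹ + (r x t
            ^ 2)⁻¹ * (r y t ^ 2)⁻¹ * (r y s ^ 2)⁻¹ + (r x t ^ 2)⁻¹ * (r y s ^ 2)⁻¹ * (r t s ^ 2)⁻¹ + (r x s ^ 2)⁻¹ * (r y t ^ 2)⁻¹ * (r y s ^ 2)⁻¹ +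
            (r x s ^ 2)⁻¹ * (r y t ^ 2)⁻¹ * (r t s ^ 2)⁻¹ + (r x y ^ 2)⁻¹ * (r x t ^ 2)⁻¹ * (r t s ^ 2)⁻¹ + (r x y ^ 2)⁻¹ * (r x s ^ 2)⁻¹ * (r t s ^
            2)⁻¹ + (r x y ^ 2)⁻¹ * (r x t ^ 2)⁻¹ * (r y s ^ 2)⁻¹ + (r x t ^ 2)⁻¹ * (r x s ^ 2)⁻¹ * (r y s ^ 2)⁻¹ + (r x y ^ 2)⁻¹ * (r x s ^ 2)⁻¹ * (r
            y t ^ 2)⁻¹ + (r x t ^ 2)⁻¹ * (r x s ^ 2)⁻¹ * (r y t ^ 2)⁻¹)) : ℝ) + (if K3 y t x = 0 then 0 else C3k / (ρ x z * ρ x s) : ℝ) + (if Hk z x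
            = 0 then 0 else if Hk t y = 0 then 0 else C3h / (ρ x y * ρ x s) : ℝ) + (if Hk s x = 0 then 0 else if Hk t y = 0 then 0 else C3h / (ρ x y
            * ρ x z) : ℝ) + (if Hk t y = 0 then 0 else C4 * (((r x y ^ 2)⁻¹ * (r x z ^ 2)⁻¹ * (r x s ^ 2)⁻¹ + (r x y ^ 2)⁻¹ * (r y z ^ 2)⁻¹ * (r y s
            ^ 2)⁻¹ + (r x z ^ 2)⁻¹ * (r y z ^ 2)⁻¹ * (r z s ^ 2)⁻¹ + (r x s ^ 2)⁻¹ * (r y s ^ 2)⁻¹ * (r z s ^ 2)⁻¹ + (r x y ^ 2)⁻¹ * (r y z ^ 2)⁻¹ *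
            (r z s ^ 2)⁻¹ + (r x y ^ 2)⁻¹ * (r y s ^ 2)⁻¹ * (r z s ^ 2)⁻¹ + (r x z ^ 2)⁻¹ * (r y z ^ 2)⁻¹ * (r y s ^ 2)⁻¹ + (r x z ^ 2)⁻¹ * (r y s ^
            2)⁻¹ * (r z s ^ 2)⁻¹ + (r x s ^ 2)⁻¹ * (r y z ^ 2)⁻¹ * (r y s ^ 2)⁻¹ + (r x s ^ 2)⁻¹ * (r y z ^ 2)⁻¹ * (r z s ^ 2)⁻¹ + (r x y ^ 2)⁻¹ * (r
            x z ^ 2)⁻¹ * (r z s ^ 2)⁻¹ + (r x y ^ 2)⁻¹ * (r x s ^ 2)⁻¹ * (r z s ^ 2)⁻¹ + (r x y ^ 2)⁻¹ * (r x z ^ 2)⁻¹ * (r y s ^ 2)⁻¹ + (r x z ^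
            2)⁻¹ * (r x s ^ 2)⁻¹ * (r y s ^ 2)⁻¹ + (r x y ^ 2)⁻¹ * (r x s ^ 2)⁻¹ * (r y z ^ 2)⁻¹ + (r x z ^ 2)⁻¹ * (r x s ^ 2)⁻¹ * (r y z ^ 2)⁻¹)) :
            ℝ) + (if K3 y s x = 0 then 0 else C3k / (ρ x z * ρ x t) : ℝ) + (if Hk z x = 0 then 0 else if Hk s y = 0 then 0 else C3h / (ρ x y * ρ x t)
            : ℝ) + (if Hk t x = 0 then 0 else if Hk s y = 0 then 0 else C3h / (ρ x y * ρ x z) : ℝ) + (if Hk s y = 0 then 0 else C4 * (((r x y ^ 2)⁻¹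
            * (r x z ^ 2)⁻¹ * (r x t ^ 2)⁻¹ + (r x y ^ 2)⁻¹ * (r y z ^ 2)⁻¹ * (r y t ^ 2)⁻¹ + (r x z ^ 2)⁻¹ * (r y z ^ 2)⁻¹ * (r z t ^ 2)⁻¹ + (r x t
            ^ 2)⁻¹ * (r y t ^ 2)⁻¹ * (r z t ^ 2)⁻¹ + (r x y ^ 2)⁻¹ * (r y z ^ 2)⁻¹ * (r z t ^ 2)⁻¹ + (r x y ^ 2)⁻¹ * (r y t ^ 2)⁻¹ * (r z t ^ 2)⁻¹ +
            (r x z ^ 2)⁻¹ * (r y z ^ 2)⁻¹ * (r y t ^ 2)⁻¹ + (r x z ^ 2)⁻¹ * (r y t ^ 2)⁻¹ * (r z t ^ 2)⁻¹ + (r x t ^ 2)⁻¹ * (r y z ^ 2)⁻¹ * (r y t ^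
            2)⁻¹ + (r x t ^ 2)⁻¹ * (r y z ^ 2)⁻¹ * (r z t ^ 2)⁻¹ + (r x y ^ 2)⁻¹ * (r x z ^ 2)⁻¹ * (r z t ^ 2)⁻¹ + (r x y ^ 2)⁻¹ * (r x t ^ 2)⁻¹ * (r
            z t ^ 2)⁻¹ + (r x y ^ 2)⁻¹ * (r x z ^ 2)⁻¹ * (r y t ^ 2)⁻¹ + (r x z ^ 2)⁻¹ * (r x t ^ 2)⁻¹ * (r y t ^ 2)⁻¹ + (r x y ^ 2)⁻¹ * (r x t ^
            2)⁻¹ * (r y z ^ 2)⁻¹ + (r x z ^ 2)⁻¹ * (r x t ^ 2)⁻¹ * (r y z ^ 2)⁻¹)) : ℝ)) +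
        ((if Hk y x = 0 then 0 else if Hk t z = 0 then 0 else C3h / (ρ x z * ρ x s) : ℝ) + (if K3 z t x = 0 then 0 else C3k / (ρ x y * ρ x s) : ℝ) +
            (if Hk s x = 0 then 0 else if Hk t z = 0 then 0 else C3h / (ρ x z * ρ x y) : ℝ) + (if Hk t z = 0 then 0 else C4 * (((r x z ^ 2)⁻¹ * (r x
            y ^ 2)⁻¹ * (r x s ^ 2)⁻¹ + (r x z ^ 2)⁻¹ * (r z y ^ 2)⁻¹ * (r z s ^ 2)⁻¹ + (r x y ^ 2)⁻¹ * (r z y ^ 2)⁻¹ * (r y s ^ 2)⁻¹ + (r x s ^ 2)⁻¹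
            * (r z s ^ 2)⁻¹ * (r y s ^ 2)⁻¹ + (r x z ^ 2)⁻¹ * (r z y ^ 2)⁻¹ * (r y s ^ 2)⁻¹ + (r x z ^ 2)⁻¹ * (r z s ^ 2)⁻¹ * (r y s ^ 2)⁻¹ + (r x y
            ^ 2)⁻¹ * (r z y ^ 2)⁻¹ * (r z s ^ 2)⁻¹ + (r x y ^ 2)⁻¹ * (r z s ^ 2)⁻¹ * (r y s ^ 2)⁻¹ + (r x s ^ 2)⁻¹ * (r z y ^ 2)⁻¹ * (r z s ^ 2)⁻¹ +
            (r x s ^ 2)⁻¹ * (r z y ^ 2)⁻¹ * (r y s ^ 2)⁻¹ + (r x z ^ 2)⁻¹ * (r x y ^ 2)⁻¹ * (r y s ^ 2)⁻¹ + (r x z ^ 2)⁻¹ * (r x s ^ 2)⁻¹ * (r y s ^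
            2)⁻¹ + (r x z ^ 2)⁻¹ * (r x y ^ 2)⁻¹ * (r z s ^ 2)⁻¹ + (r x y ^ 2)⁻¹ * (r x s ^ 2)⁻¹ * (r z s ^ 2)⁻¹ + (r x z ^ 2)⁻¹ * (r x s ^ 2)⁻¹ * (r
            z y ^ 2)⁻¹ + (r x y ^ 2)⁻¹ * (r x s ^ 2)⁻¹ * (r z y ^ 2)⁻¹)) : ℝ) + (if Hk y x = 0 then 0 else if Hk s z = 0 then 0 else C3h / (ρ x z * ρ
            x t) : ℝ) + (if K3 z s x = 0 then 0 else C3k / (ρ x y * ρ x t) : ℝ) + (if Hk t x = 0 then 0 else if Hk s z = 0 then 0 else C3h / (ρ x z *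
            ρ x y) : ℝ) + (if Hk s z = 0 then 0 else C4 * (((r x z ^ 2)⁻¹ * (r x y ^ 2)⁻¹ * (r x t ^ 2)⁻¹ + (r x z ^ 2)⁻¹ * (r z y ^ 2)⁻¹ * (r z t ^
            2)⁻¹ + (r x y ^ 2)⁻¹ * (r z y ^ 2)⁻¹ * (r y t ^ 2)⁻¹ + (r x t ^ 2)⁻¹ * (r z t ^ 2)⁻¹ * (r y t ^ 2)⁻¹ + (r x z ^ 2)⁻¹ * (r z y ^ 2)⁻¹ * (r
            y t ^ 2)⁻¹ + (r x z ^ 2)⁻¹ * (r z t ^ 2)⁻¹ * (r y t ^ 2)⁻¹ + (r x y ^ 2)⁻¹ * (r z y ^ 2)⁻¹ * (r z t ^ 2)⁻¹ + (r x y ^ 2)⁻¹ * (r z t ^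
            2)⁻¹ * (r y t ^ 2)⁻¹ + (r x t ^ 2)⁻¹ * (r z y ^ 2)⁻¹ * (r z t ^ 2)⁻¹ + (r x t ^ 2)⁻¹ * (r z y ^ 2)⁻¹ * (r y t ^ 2)⁻¹ + (r x z ^ 2)⁻¹ * (r
            x y ^ 2)⁻¹ * (r y t ^ 2)⁻¹ + (r x z ^ 2)⁻¹ * (r x t ^ 2)⁻¹ * (r y t ^ 2)⁻¹ + (r x z ^ 2)⁻¹ * (r x y ^ 2)⁻¹ * (r z t ^ 2)⁻¹ + (r x y ^
            2)⁻¹ * (r x t ^ 2)⁻¹ * (r z t ^ 2)⁻¹ + (r x z ^ 2)⁻¹ * (r x t ^ 2)⁻¹ * (r z y ^ 2)⁻¹ + (r x y ^ 2)⁻¹ * (r x t ^ 2)⁻¹ * (r z y ^ 2)⁻¹)) :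
            ℝ) + (if Hk y x = 0 then 0 else if Hk s t = 0 then 0 else C3h / (ρ x t * ρ x z) : ℝ) + (if K3 t s x = 0 then 0 else C3k / (ρ x y * ρ x z)
            : ℝ) + (if Hk z x = 0 then 0 else if Hk s t = 0 then 0 else C3h / (ρ x t * ρ x y) : ℝ) + (if Hk s t = 0 then 0 else C4 * (((r x t ^ 2)⁻¹
            * (r x y ^ 2)⁻¹ * (r x z ^ 2)⁻¹ + (r x t ^ 2)⁻¹ * (r t y ^ 2)⁻¹ * (r t z ^ 2)⁻¹ + (r x y ^ 2)⁻¹ * (r t y ^ 2)⁻¹ * (r y z ^ 2)⁻¹ + (r x z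
            ^ 2)⁻¹ * (r t z ^ 2)⁻¹ * (r y z ^ 2)⁻¹ + (r x t ^ 2)⁻¹ * (r t y ^ 2)⁻¹ * (r y z ^ 2)⁻¹ + (r x t ^ 2)⁻¹ * (r t z ^ 2)⁻¹ * (r y z ^ 2)⁻¹ +
            (r x y ^ 2)⁻¹ * (r t y ^ 2)⁻¹ * (r t z ^ 2)⁻¹ + (r x y ^ 2)⁻¹ * (r t z ^ 2)⁻¹ * (r y z ^ 2)⁻¹ + (r x z ^ 2)⁻¹ * (r t y ^ 2)⁻¹ * (r t z ^
            2)⁻¹ + (r x z ^ 2)⁻¹ * (r t y ^ 2)⁻¹ * (r y z ^ 2)⁻¹ + (r x t ^ 2)⁻¹ * (r x y ^ 2)⁻¹ * (r y z ^ 2)⁻¹ + (r x t ^ 2)⁻¹ * (r x z ^ 2)⁻¹ * (r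
            y z ^ 2)⁻¹ + (r x t ^ 2)⁻¹ * (r x y ^ 2)⁻¹ * (r t z ^ 2)⁻¹ + (r x y ^ 2)⁻¹ * (r x z ^ 2)⁻¹ * (r t z ^ 2)⁻¹ + (r x t ^ 2)⁻¹ * (r x z ^
            2)⁻¹ * (r t y ^ 2)⁻¹ + (r x y ^ 2)⁻¹ * (r x z ^ 2)⁻¹ * (r t y ^ 2)⁻¹)) : ℝ)) +
        ((if Hk y x = 0 then 0 else C4 * (((r x z ^ 2)⁻¹ * (r x t ^ 2)⁻¹ * (r x s ^ 2)⁻¹ + (r x z ^ 2)⁻¹ * (r z t ^ 2)⁻¹ * (r z s ^ 2)⁻¹ + (r x t ^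
            2)⁻¹ * (r z t ^ 2)⁻¹ * (r t s ^ 2)⁻¹ + (r x s ^ 2)⁻¹ * (r z s ^ 2)⁻¹ * (r t s ^ 2)⁻¹ + (r x z ^ 2)⁻¹ * (r z t ^ 2)⁻¹ * (r t s ^ 2)⁻¹ + (r
            x z ^ 2)⁻¹ * (r z s ^ 2)⁻¹ * (r t s ^ 2)⁻¹ + (r x t ^ 2)⁻¹ * (r z t ^ 2)⁻¹ * (r z s ^ 2)⁻¹ + (r x t ^ 2)⁻¹ * (r z s ^ 2)⁻¹ * (r t s ^
            2)⁻¹ + (r x s ^ 2)⁻¹ * (r z t ^ 2)⁻¹ * (r z s ^ 2)⁻¹ + (r x s ^ 2)⁻¹ * (r z t ^ 2)⁻¹ * (r t s ^ 2)⁻¹ + (r x z ^ 2)⁻¹ * (r x t ^ 2)⁻¹ * (r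
            t s ^ 2)⁻¹ + (r x z ^ 2)⁻¹ * (r x s ^ 2)⁻¹ * (r t s ^ 2)⁻¹ + (r x z ^ 2)⁻¹ * (r x t ^ 2)⁻¹ * (r z s ^ 2)⁻¹ + (r x t ^ 2)⁻¹ * (r x s ^
            2)⁻¹ * (r z s ^ 2)⁻¹ + (r x z ^ 2)⁻¹ * (r x s ^ 2)⁻¹ * (r z t ^ 2)⁻¹ + (r x t ^ 2)⁻¹ * (r x s ^ 2)⁻¹ * (r z t ^ 2)⁻¹)) : ℝ) + (if Hk z x
            = 0 then 0 else C4 * (((r x y ^ 2)⁻¹ * (r x t ^ 2)⁻¹ * (r x s ^ 2)⁻¹ + (r x y ^ 2)⁻¹ * (r y t ^ 2)⁻¹ * (r y s ^ 2)⁻¹ + (r x t ^ 2)⁻¹ * (r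
            y t ^ 2)⁻¹ * (r t s ^ 2)⁻¹ + (r x s ^ 2)⁻¹ * (r y s ^ 2)⁻¹ * (r t s ^ 2)⁻¹ + (r x y ^ 2)⁻¹ * (r y t ^ 2)⁻¹ * (r t s ^ 2)⁻¹ + (r x y ^
            2)⁻¹ * (r y s ^ 2)⁻¹ * (r t s ^ 2)⁻¹ + (r x t ^ 2)⁻¹ * (r y t ^ 2)⁻¹ * (r y s ^ 2)⁻¹ + (r x t ^ 2)⁻¹ * (r y s ^ 2)⁻¹ * (r t s ^ 2)⁻¹ + (r
            x s ^ 2)⁻¹ * (r y t ^ 2)⁻¹ * (r y s ^ 2)⁻¹ + (r x s ^ 2)⁻¹ * (r y t ^ 2)⁻¹ * (r t s ^ 2)⁻¹ + (r x y ^ 2)⁻¹ * (r x t ^ 2)⁻¹ * (r t s ^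
            2)⁻¹ + (r x y ^ 2)⁻¹ * (r x s ^ 2)⁻¹ * (r t s ^ 2)⁻¹ + (r x y ^ 2)⁻¹ * (r x t ^ 2)⁻¹ * (r y s ^ 2)⁻¹ + (r x t ^ 2)⁻¹ * (r x s ^ 2)⁻¹ * (r
            y s ^ 2)⁻¹ + (r x y ^ 2)⁻¹ * (r x s ^ 2)⁻¹ * (r y t ^ 2)⁻¹ + (r x t ^ 2)⁻¹ * (r x s ^ 2)⁻¹ * (r y t ^ 2)⁻¹)) : ℝ) + (if Hk t x = 0 then 0
            else C4 * (((r x y ^ 2)⁻¹ * (r x z ^ 2)⁻¹ * (r x s ^ 2)⁻¹ + (r x y ^ 2)⁻¹ * (r y z ^ 2)⁻¹ * (r y s ^ 2)⁻¹ + (r x z ^ 2)⁻¹ * (r y z ^ 2)⁻¹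
            * (r z s ^ 2)⁻¹ + (r x s ^ 2)⁻¹ * (r y s ^ 2)⁻¹ * (r z s ^ 2)⁻¹ + (r x y ^ 2)⁻¹ * (r y z ^ 2)⁻¹ * (r z s ^ 2)⁻¹ + (r x y ^ 2)⁻¹ * (r y s
            ^ 2)⁻¹ * (r z s ^ 2)⁻¹ + (r x z ^ 2)⁻¹ * (r y z ^ 2)⁻¹ * (r y s ^ 2)⁻¹ + (r x z ^ 2)⁻¹ * (r y s ^ 2)⁻¹ * (r z s ^ 2)⁻¹ + (r x s ^ 2)⁻¹ *
            (r y z ^ 2)⁻¹ * (r y s ^ 2)⁻¹ + (r x s ^ 2)⁻¹ * (r y z ^ 2)⁻¹ * (r z s ^ 2)⁻¹ + (r x y ^ 2)⁻¹ * (r x z ^ 2)⁻¹ * (r z s ^ 2)⁻¹ + (r x y ^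
            2)⁻¹ * (r x s ^ 2)⁻¹ * (r z s ^ 2)⁻¹ + (r x y ^ 2)⁻¹ * (r x z ^ 2)⁻¹ * (r y s ^ 2)⁻¹ + (r x z ^ 2)⁻¹ * (r x s ^ 2)⁻¹ * (r y s ^ 2)⁻¹ + (r
            x y ^ 2)⁻¹ * (r x s ^ 2)⁻¹ * (r y z ^ 2)⁻¹ + (r x z ^ 2)⁻¹ * (r x s ^ 2)⁻¹ * (r y z ^ 2)⁻¹)) : ℝ) + (if Hk s x = 0 then 0 else C4 * (((r
            x y ^ 2)⁻¹ * (r x z ^ 2)⁻¹ * (r x t ^ 2)⁻¹ + (r x y ^ 2)⁻¹ * (r y z ^ 2)⁻¹ * (r y t ^ 2)⁻¹ + (r x z ^ 2)⁻¹ * (r y z ^ 2)⁻¹ * (r z t ^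
            2)⁻¹ + (r x t ^ 2)⁻¹ * (r y t ^ 2)⁻¹ * (r z t ^ 2)⁻¹ + (r x y ^ 2)⁻¹ * (r y z ^ 2)⁻¹ * (r z t ^ 2)⁻¹ + (r x y ^ 2)⁻¹ * (r y t ^ 2)⁻¹ * (r
            z t ^ 2)⁻¹ + (r x z ^ 2)⁻¹ * (r y z ^ 2)⁻¹ * (r y t ^ 2)⁻¹ + (r x z ^ 2)⁻¹ * (r y t ^ 2)⁻¹ * (r z t ^ 2)⁻¹ + (r x t ^ 2)⁻¹ * (r y z ^
            2)⁻¹ * (r y t ^ 2)⁻¹ + (r x t ^ 2)⁻¹ * (r y z ^ 2)⁻¹ * (r z t ^ 2)⁻¹ + (r x y ^ 2)⁻¹ * (r x z ^ 2)⁻¹ * (r z t ^ 2)⁻¹ + (r x y ^ 2)⁻¹ * (r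
            x t ^ 2)⁻¹ * (r z t ^ 2)⁻¹ + (r x y ^ 2)⁻¹ * (r x z ^ 2)⁻¹ * (r y t ^ 2)⁻¹ + (r x z ^ 2)⁻¹ * (r x t ^ 2)⁻¹ * (r y t ^ 2)⁻¹ + (r x y ^
            2)⁻¹ * (r x t ^ 2)⁻¹ * (r y z ^ 2)⁻¹ + (r x z ^ 2)⁻¹ * (r x t ^ 2)⁻¹ * (r y z ^ 2)⁻¹)) : ℝ) + (C5 * (min (max (r x y)⁻¹ (max (r x z)⁻¹
            (max (r x t)⁻¹ (r x s)⁻¹))) (min (max (r x z)⁻¹ (max (r y z)⁻¹ (max (r x t)⁻¹ (max (r y t)⁻¹ (max (r x s)⁻¹ (r y s)⁻¹))))) (min (max (r x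
            y)⁻¹ (max (r y z)⁻¹ (max (r x t)⁻¹ (max (r z t)⁻¹ (max (r x s)⁻¹ (r z s)⁻¹))))) (min (max (r x y)⁻¹ (max (r y t)⁻¹ (max (r x z)⁻¹ (max (r
            z t)⁻¹ (max (r x s)⁻¹ (r t s)⁻¹))))) (min (max (r x y)⁻¹ (max (r y s)⁻¹ (max (r x z)⁻¹ (max (r z s)⁻¹ (max (r x t)⁻¹ (r t s)⁻¹))))) (min
            (max (r x t)⁻¹ (max (r y t)⁻¹ (max (r z t)⁻¹ (max (r x s)⁻¹ (max (r y s)⁻¹ (r z s)⁻¹))))) (min (max (r x z)⁻¹ (max (r y z)⁻¹ (max (r z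
            t)⁻¹ (max (r x s)⁻¹ (max (r y s)⁻¹ (r t s)⁻¹))))) (min (max (r x z)⁻¹ (max (r y z)⁻¹ (max (r z s)⁻¹ (max (r x t)⁻¹ (max (r y t)⁻¹ (r t
            s)⁻¹))))) (min (max (r x y)⁻¹ (max (r y z)⁻¹ (max (r y t)⁻¹ (max (r x s)⁻¹ (max (r z s)⁻¹ (r t s)⁻¹))))) (min (max (r x y)⁻¹ (max (r y
            z)⁻¹ (max (r y s)⁻¹ (max (r x t)⁻¹ (max (r z t)⁻¹ (r t s)⁻¹))))) (min (max (r x y)⁻¹ (max (r y t)⁻¹ (max (r y s)⁻¹ (max (r x z)⁻¹ (max (r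
            z t)⁻¹ (r z s)⁻¹))))) (min (max (r x s)⁻¹ (max (r y s)⁻¹ (max (r z s)⁻¹ (r t s)⁻¹))) (min (max (r x t)⁻¹ (max (r y t)⁻¹ (max (r z t)⁻¹ (r
            t s)⁻¹))) (min (max (r x z)⁻¹ (max (r y z)⁻¹ (max (r z t)⁻¹ (r z s)⁻¹))) (max (r x y)⁻¹ (max (r y z)⁻¹ (max (r y t)⁻¹ (r y
            s)⁻¹))))))))))))))))) ^ 4 : ℝ))) ≤
      k5s2 +
        2 * (αr * k5s2 * (αc * hc) * dr * dc / (1 - lamA)) +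
        αr * hr * (αc * k5c) * dr * dc / (1 - lamA) +
        2 * (αr * k3m * (αc * k4c) * dr * dc / (1 - lamA)) +
        10 * (n₃ * (C3k * S ^ 2)) +
        2 * (αr * k5s3 * (αc * hc) * dr * dc / (1 - lamA)) +
        4 * (αr * k4s2 * (αc * k3c) * dr * dc / (1 - lamA)) +
        αr * k4r * (αc * k3c) * dr * dc / (1 - lamA) +
        αr * k4s3 * (αc * k3c) * dr * dc / (1 - lamA) +
        15 * ((n : ℝ) * n * (C3h * S ^ 2)) +
        2 * (αr * k3r * (αc * k4c) * dr * dc / (1 - lamA)) +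
        10 * ((n : ℝ) * (C4 * (16 * S' ^ 3))) +
        C5 * (576 * S₁ ^ 4) := by
  have g1 := slot_z_mean hK50 hHk0 hhc hk5s2 hαr hαc hlamA1 hD hDr hDc z
  have g2 := slot_z_covCA hK50 hK40 hK30 hHk0 hhr hhc hk3m hk3c hk4r hk4s2 hk4c hk5s2 hk5s3 hk5c hαr hαc hlamA1 hD hDr hDc hρ1 hρsymm hS hn3 hn3f
      hC3k0 z
  have g3 := slot_z_covBB hK40 hK30 hk3r hk3m hk3c hk4s2 hk4s3 hk4c hαr hαc hlamA1 hD hDr hDc hρ1 hρsymm hS hn hn' hC3h0 z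
  have g4 := slot_z_kappa3B hρ1 hρsymm hS hrs hSr hn hn' hn3 hn3m hC3k0 hC3h0 hC40 z
  have g5 := slot_z_kappa3A hρ1 hρsymm hS hrs hSr hn hn' hn3 hn3f hC3k0 hC3h0 hC40 z
  have g6 := slot_z_u4 hr1 hrs hSr hSc hS1 hn hn' hC40 hC50 z
  rw [sum4_add, sum4_add, sum4_add, sum4_add, sum4_add]
  exact (add_le_add (add_le_add (add_le_add (add_le_add (add_le_add g1 g2) g3) g4) g5) g6).trans (le_of_eq (by ring))

/-- Toy (the six blocks): `2 + 12 + 9 + 12 + 12 + 5 = 52`. -/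
example : 2 + 12 + 9 + 12 + 12 + 5 = 52 := by norm_num

end Summit.QuantumFields.BalabanUV.T4Continuum.NE7b.SupFifthKernelEntryLetterSlotThree

end
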